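import Summits.Ventures.PercRepro.C041BlockMapPendantExits
import Summits.Ventures.PercRepro.C041BlockMapTransport
import Summits.Ventures.PercRepro.C041BlockMapReductions

/-!
# ROW C-041 — THEOREM (FOREST HOSTS ARE CONE HOSTS): every forest host, with any family of exits and any of its
vertices as the anchor, is a cone host (p6, gen 37; the successor item (3) of `C041BlockMapFourCores`, in
block-map form)

A host is a CONE HOST FOR EVERY FAMILY OF EXITS (`ConeHostAll Z a`) when `ConeHost Z u a` holds for every finite
family `u` of exits — CONJECTURE (BLOCK MAP) at the anchor `a` in its strongest form (THEOREM (UNIT EXIT): the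
conjecture is monotone in the exits).  The property passes from a host to the host with a pendant vertex
(THEOREM (PENDANT VERTEX WITH EXITS), `C041BlockMapPendantExits`), with an isolated vertex (THEOREM (ISOLATED
VERTEX WITH EXITS)), with a loop, and along isomorphisms of hosts; the point host has it (THEOREM (COINCIDENT
EXITS)).  THE FOREST HOSTS `ForestGrown Z a` are the hosts grown from the point `a` by pendant and isolated
vertices, up to isomorphism — every finite forest with a distinguished vertex.  **THEOREM (FOREST HOSTS ARE CONE
HOSTS)** (`coneHost_of_forestGrown`): every forest host is a cone host for every family of exits.  In the zone
formalism (THEOREM (BLOCK MAP, `r` EXITS), `sixVec_hang_eq_blockMap`): cone zones hung at any vertices of any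
forest give a cone zone at any vertex of the forest.
-/

namespace PercRepro

namespace ZoneZ

namespace MultiExit

open ZoneData Pendant Finset TwoExit TreeClosure

/-! ## Cone hosts for every family of exits -/

/-- A host is a CONE HOST FOR EVERY FAMILY OF EXITS at the anchor `a` when it is a cone host for every finite
family of exits. -/
def ConeHostAll {V E U₁ U₂ : Type} [Fintype E] [DecidableEq E] (Z : ZoneData V E U₁ U₂) (a : V) : Prop :=
  ∀ {ι : Type} [Fintype ι] [DecidableEq ι] (u : ι → V), ConeHost Z u a

/-- A cone host for every family of exits is a cone host for each. -/
theorem ConeHostAll.coneHost {ι V E U₁ U₂ : Type} [Fintype E] [DecidableEq E] [Fintype ι] [DecidableEq ι]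
    {Z : ZoneData V E U₁ U₂} {a : V} (h : ConeHostAll Z a) (u : ι → V) : ConeHost Z u a :=
  h u

/-! ## The point host -/

/-- THE POINT HOST: one vertex, no edges. -/
def pointHost : ZoneData Unit Empty Empty Empty where
  fst := Empty.elim
  snd := Empty.elim
  at₁ := Empty.elim
  at₂ := Empty.elim

/-- The point host is a cone host for every family of exits (all of them at its vertex). -/
theorem coneHostAll_point : ConeHostAll pointHost () := by
  intro ι _ _ u
  have hu : u = fun _ => () := funext fun _ => rfl
  rw [hu]
  exact coneHost_const' pointHost () ()

/-! ## The property passes along the constructions -/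

section Steps

variable {V₁ E₁ U₁ U₂ : Type} (Z₁ : ZoneData V₁ E₁ U₁ U₂) (a₁ : V₁) [Fintype E₁] [DecidableEq E₁]

/-- A pendant vertex: THEOREM (PENDANT VERTEX WITH EXITS) for every family. -/
theorem coneHostAll_addPendant (h : ConeHostAll Z₁ a₁) (x : V₁) : ConeHostAll (addPendant Z₁ x) (some a₁) := by
  intro ι _ _ u'
  exact coneHost_addPendant_of_uplus Z₁ x a₁ u' (h _)

/-- An isolated vertex: THEOREM (ISOLATED VERTEX WITH EXITS) for every family. -/
theorem coneHostAll_addIsolated (h : ConeHostAll Z₁ a₁) : ConeHostAll (addIsolated Z₁) (some a₁) := by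
  intro ι _ _ u'
  exact coneHost_addIsolated_of Z₁ a₁ u' (h _)

/-- A loop doubles the block map. -/
theorem coneHostAll_addLoop (h : ConeHostAll Z₁ a₁) (x : V₁) : ConeHostAll (addLoop Z₁ x) a₁ := by
  intro ι _ _ u w hw
  rw [blockMap_addLoop]
  exact (h u w hw).smul 2 (by norm_num)

variable {V₂ E₂ W₁ W₂ : Type} (Z₂ : ZoneData V₂ E₂ W₁ W₂) [Fintype E₂] [DecidableEq E₂]

/-- An isomorphic host (the block map is invariant under isomorphisms). -/
theorem coneHostAll_iso (fv : V₁ ≃ V₂) (fe : E₁ ≃ E₂)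
    (hJ : ∀ e x y, Z₂.Joins (fe e) (fv x) (fv y) ↔ Z₁.Joins e x y) (h : ConeHostAll Z₁ a₁) :
    ConeHostAll Z₂ (fv a₁) := by
  intro ι _ _ u w hw
  have hu : u = fv ∘ (fv.symm ∘ u) := by
    funext k
    simp only [Function.comp_apply, Equiv.apply_symm_apply]
  rw [hu, blockMap_iso Z₁ Z₂ fv fe hJ]
  exact h _ w hw

end Steps

/-! ## The forest hosts -/

/-- THE FOREST HOSTS: grown from the point by pendant vertices (attached anywhere) and isolated vertices, up to
isomorphism of hosts — every finite forest with a distinguished vertex, the anchor. -/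
inductive ForestGrown : ∀ {V E U₁ U₂ : Type} [Fintype E] [DecidableEq E], ZoneData V E U₁ U₂ → V → Prop
  /-- the point -/
  | point : ForestGrown pointHost ()
  /-- a pendant vertex at `x` -/
  | pendant {V E U₁ U₂ : Type} [Fintype E] [DecidableEq E] (Z : ZoneData V E U₁ U₂) (a x : V)
      (h : ForestGrown Z a) : ForestGrown (addPendant Z x) (some a)
  /-- an isolated vertex -/
  | isolated {V E U₁ U₂ : Type} [Fintype E] [DecidableEq E] (Z : ZoneData V E U₁ U₂) (a : V)
      (h : ForestGrown Z a) : ForestGrown (addIsolated Z) (some a)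
  /-- an isomorphic host -/
  | iso {V₁ E₁ U₁ W₁ V₂ E₂ U₂ W₂ : Type} [Fintype E₁] [DecidableEq E₁] [Fintype E₂] [DecidableEq E₂]
      (Z₁ : ZoneData V₁ E₁ U₁ W₁) (Z₂ : ZoneData V₂ E₂ U₂ W₂) (fv : V₁ ≃ V₂) (fe : E₁ ≃ E₂)
      (hJ : ∀ e x y, Z₂.Joins (fe e) (fv x) (fv y) ↔ Z₁.Joins e x y) (a : V₁) (h : ForestGrown Z₁ a) :
      ForestGrown Z₂ (fv a)

/-- **THEOREM (FOREST HOSTS ARE CONE HOSTS)**, strongest form: every forest host is a cone host for every family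
of exits. -/
theorem coneHostAll_of_forestGrown {V E U₁ U₂ : Type} [Fintype E] [DecidableEq E] {Z : ZoneData V E U₁ U₂}
    {a : V} (h : ForestGrown Z a) : ConeHostAll Z a := by
  induction h with
  | point => exact coneHostAll_point
  | pendant Z a x _ ih => exact coneHostAll_addPendant Z a ih x
  | isolated Z a _ ih => exact coneHostAll_addIsolated Z a ih
  | iso Z₁ Z₂ fv fe hJ a _ ih => exact coneHostAll_iso Z₁ a Z₂ fv fe hJ ih

/-- **THEOREM (FOREST HOSTS ARE CONE HOSTS)**: every forest host, with any family of exits, is a cone host —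
CONJECTURE (BLOCK MAP) holds for every forest. -/
theorem coneHost_of_forestGrown {ι V E U₁ U₂ : Type} [Fintype E] [DecidableEq E] [Fintype ι] [DecidableEq ι]
    {Z : ZoneData V E U₁ U₂} {a : V} (h : ForestGrown Z a) (u : ι → V) : ConeHost Z u a :=
  coneHostAll_of_forestGrown h u

/-- Every forest host is a built host (`Built.core`), for every family of exits. -/
theorem built_of_forestGrown {ι V E U₁ U₂ : Type} [Fintype E] [DecidableEq E] [Fintype ι] [DecidableEq ι]
    {Z : ZoneData V E U₁ U₂} {a : V} (h : ForestGrown Z a) (u : ι → V) : Built Z u a :=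
  Built.core Z u a (coneHost_of_forestGrown h u)

/-- The block map of a forest host sends every family of cone members into the cone. -/
theorem inCone_blockMap_of_forestGrown {ι V E U₁ U₂ : Type} [Fintype E] [DecidableEq E] [Fintype ι]
    [DecidableEq ι] {Z : ZoneData V E U₁ U₂} {a : V} (h : ForestGrown Z a) (u : ι → V) (w : ι → Vec6)
    (hw : ∀ k, InCone (w k)) : InCone (blockMap Z u a w) :=
  coneHost_of_forestGrown h u w hw

/-! ## Forests with loops -/

/-- Loops added to a forest host keep it a cone host for every family of exits. -/
theorem coneHostAll_addLoop_of_forestGrown {V E U₁ U₂ : Type} [Fintype E] [DecidableEq E]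
    {Z : ZoneData V E U₁ U₂} {a : V} (h : ForestGrown Z a) (x : V) : ConeHostAll (addLoop Z x) a :=
  coneHostAll_addLoop Z a (coneHostAll_of_forestGrown h) x

end MultiExit

end ZoneZ

end PercRepro
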